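import Summits.CriticalPhenomena.CardyFormulaZ2.Theorems.CardyBoundaryCoulombGasRectilinearCardyStubBoundaryFeetPart6
import HarnessLib

/-!
# Stub `stub_boundaryFeet` of line `excursion-kernel-covariance` — Part 7:
# parameters of the chain darts in an oriented wedge (crux `RectilinearCardy`,
# stmt-CriticalPhenomena-5660)

* `bft_dart_param` — inside an oriented wedge (apex `γ t₀`, frame `K`, type `m`) the foot of
  every chain dart is `γ u` for a window parameter `u ∈ (t₀ - η, t₀ + η)` whose signed position
  `bftSpos D t₀ u` is the lattice signed position `bftSposZ … ι` (Part 6 places the foot on the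
  outgoing / incoming ray; Part 3 parametrises the rays);
* `bft_chain_data` — for a chain dart whose vertex sees the chart: it is exterior, the walk moves
  to the next chain dart, and its foot parameter `bftPar` is such a `u` up to an integer;
* `bft_small_diff` — a real within `1/4` of an integer and of size `≤ 1/2` is within `1/4` of `0`.
All [folklore].
-/

noncomputable section

open Set Filter Metric Topology
open Literature.Probability.RandomPlanarGeometry
open Literature.Probability.LatticeModels Literature.Probability.LatticeModels.CollarLegModel
open Summit.CriticalPhenomena.CardyFormulaZ2.Cruxes.BoundaryDefectGaussianR.RainbowMonomialsInExcursionKernels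

namespace Summit.CriticalPhenomena.CardyFormulaZ2.Cruxes.RectilinearCardy.ExcursionKernelCovariance

/-- A real number within `η' ≤ 1/4` of an integer and of absolute value `≤ 1/2` is within `η'`
of `0`. [folklore] -/
theorem bft_small_diff {η' x : ℝ} (hη' : η' ≤ 1 / 4) (hx : |x| ≤ 1 / 2) {n : ℤ}
    (h : |x - n| < η') : n = 0 := by
  rw [abs_le] at hx
  rw [abs_lt] at h
  have h1 : n < 1 := by
    by_contra hc
    have : (1 : ℝ) ≤ n := by exact_mod_cast (show 1 ≤ n by omega)
    linarith
  have h2 : -1 < n := by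
    by_contra hc
    have : (n : ℝ) ≤ -1 := by exact_mod_cast (show n ≤ -1 by omega)
    linarith
  omega

/-- Frame displacements of size `≤ 3` move mesh points by at most `5 δ`. [folklore] -/
theorem bft_mesh_frame_dist3 {δ : ℝ} (hδ : 0 ≤ δ) (K : Fin 4) (v : ℤ × ℤ) {s t : ℤ}
    (hs1 : -3 ≤ s) (hs2 : s ≤ 3) (ht1 : -3 ≤ t) (ht2 : t ≤ 3) :
    dist (bftMesh δ (v + s • dir K + t • dir (K + 1))) (bftMesh δ v) ≤ δ * 5 := by
  have h3 := (tp_dot_lin K v s t).2.2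
  refine tp_mesh_dist_le hδ (by norm_num) (v + s • dir K + t • dir (K + 1)) v ?_
  rw [h3]
  have hs := sq_le_sq' hs1 hs2
  have ht := sq_le_sq' ht1 ht2
  push_cast
  have hs' : (s : ℝ) ^ 2 ≤ 3 ^ 2 := by exact_mod_cast hs
  have ht' : (t : ℝ) ^ 2 ≤ 3 ^ 2 := by exact_mod_cast ht
  linarith

/-- **Chain vertices a few steps ahead are close.** [folklore] -/
theorem bft_vert_shift_dist {m : ℕ} (hm : m = 1 ∨ m = 2 ∨ m = 3) {δ : ℝ} (hδ : 0 ≤ δ) (K : Fin 4)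
    (X Y ι : ℤ) {j : ℕ} (hj : j ≤ 3) :
    dist (bftMesh δ (bftVert m K X Y (ι + j))) (bftMesh δ (bftVert m K X Y ι)) ≤ δ * 5 := by
  obtain ⟨s, t, he, hs1, hs2, ht1, ht2⟩ := bft_vert_shift hm K X Y ι j
  rw [he]
  have hj' : (j : ℤ) ≤ 3 := by exact_mod_cast hj
  exact bft_mesh_frame_dist3 hδ K _ (by omega) (by omega) (by omega) (by omega)

/-- **Parameters of the chain darts.** See the module docstring. [folklore] -/
theorem bft_dart_param (D : JordanDomain) {δ : ℝ} (hδ : 0 < δ) {V : Finset (ℤ × ℤ)}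
    (hV : ∀ v : ℤ × ℤ, v ∈ V ↔ bftMesh δ v ∈ closure D.carrier) {t₀ r η : ℝ} (K : Fin 4) {m : ℕ}
    (hη : 0 < η) (hm : m = 1 ∨ m = 2 ∨ m = 3)
    (hdirA : ∀ t ∈ Icc t₀ (t₀ + η), D.boundary t =
      D.boundary t₀ + ((‖D.boundary t - D.boundary t₀‖ : ℝ) : ℂ) * Complex.I ^ (K : ℕ))
    (hrA : r < ‖D.boundary (t₀ + η) - D.boundary t₀‖)
    (hdirB : ∀ t ∈ Icc (t₀ - η) t₀, D.boundary t =
      D.boundary t₀ + ((‖D.boundary t - D.boundary t₀‖ : ℝ) : ℂ) * Complex.I ^ ((K : ℕ) + m))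
    (hrB : r < ‖D.boundary (t₀ - η) - D.boundary t₀‖)
    (hclos : ∀ z, dist z (D.boundary t₀) < r → (z ∈ closure D.carrier ↔
      (m = 1 → 0 ≤ ((z - D.boundary t₀) * (-Complex.I) ^ (K : ℕ)).re ∧
          0 ≤ ((z - D.boundary t₀) * (-Complex.I) ^ (K : ℕ)).im) ∧
        (m = 2 → 0 ≤ ((z - D.boundary t₀) * (-Complex.I) ^ (K : ℕ)).im) ∧
        (m = 3 → 0 ≤ ((z - D.boundary t₀) * (-Complex.I) ^ (K : ℕ)).im ∨
          ((z - D.boundary t₀) * (-Complex.I) ^ (K : ℕ)).re ≤ 0)))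
    (ι : ℤ)
    (hnear : ∀ z, dist z (bftMesh δ (bftVert m K
      (bftX m δ (D.boundary t₀ * (-Complex.I) ^ (K : ℕ)).re)
      ⌈(D.boundary t₀ * (-Complex.I) ^ (K : ℕ)).im / δ⌉ ι)) ≤ 3 * δ → dist z (D.boundary t₀) < r) :
    ∃ u, u ∈ Ioo (t₀ - η) (t₀ + η) ∧
      D.boundary u = bftPhi D δ (bftVert m K (bftX m δ (D.boundary t₀ * (-Complex.I) ^ (K : ℕ)).re)
        ⌈(D.boundary t₀ * (-Complex.I) ^ (K : ℕ)).im / δ⌉ ι, K + bftKoff m ι) ∧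
      bftSpos D t₀ u = bftSposZ m δ (D.boundary t₀ * (-Complex.I) ^ (K : ℕ)).re
        (D.boundary t₀ * (-Complex.I) ^ (K : ℕ)).im
        (bftX m δ (D.boundary t₀ * (-Complex.I) ^ (K : ℕ)).re)
        ⌈(D.boundary t₀ * (-Complex.I) ^ (K : ℕ)).im / δ⌉ ι := by
  set p := D.boundary t₀ with hp
  set Pre := (p * (-Complex.I) ^ (K : ℕ)).re with hPre
  set Pim := (p * (-Complex.I) ^ (K : ℕ)).im with hPim
  set X := bftX m δ Pre with hX
  set Y := ⌈Pim / δ⌉ with hY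
  set v := bftVert m K X Y ι with hv
  have hnear1 : ∀ z, dist z (bftMesh δ v) ≤ δ → dist z p < r := fun z hz => hnear z (by linarith)
  -- the vertex is in `V`, so its foot is within `δ` of its mesh point
  have hch := bft_frame_chart D hδ hV K hm hclos v hnear
  obtain ⟨hvV, -, -⟩ := bft_ext_succ V hm K X Y ι hch
  have hvcl : bftMesh δ v ∈ closure D.carrier := (hV v).1 hvV
  have hdist : ∀ k : Fin 4, dist (bftPhi D δ (v, k)) p < r := by
    intro k
    have h1 := (bft_dist_phi_mesh D hδ.le (v, k) hvcl).2
    exact hnear1 _ h1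
  have hnormI : ∀ n : ℕ, ‖Complex.I ^ n‖ = 1 := fun n => by
    rw [norm_pow, Complex.norm_I, one_pow]
  have hwin1 : ∀ u, u ∈ Ico t₀ (t₀ + η) → u ∈ Ioo (t₀ - η) (t₀ + η) := fun u hu =>
    ⟨by linarith [hu.1], hu.2⟩
  have hwin2 : ∀ u, u ∈ Ioc (t₀ - η) t₀ → u ∈ Ioo (t₀ - η) (t₀ + η) := fun u hu =>
    ⟨hu.1, by linarith [hu.2]⟩
  by_cases hf : m = 2 ∨ 0 ≤ ι
  · obtain ⟨hphi, hsign⟩ := bft_foot_fwd D hδ K hm hclos hf hnear1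
    rw [(bft_vert_fwd K X Y hf).2] at hphi ⊢
    set x := bftSposZ m δ Pre Pim X Y ι with hx
    have hxr : |x| < r := by
      have h := hdist (K + 3)
      rw [hphi, dist_eq_norm, add_sub_cancel_left, norm_mul, hnormI, mul_one, Complex.norm_real,
        Real.norm_eq_abs] at h
      exact h
    by_cases hx0 : 0 ≤ x
    · obtain ⟨u, hu, hγu, hsu⟩ := bft_ray_fwd D hη hdirA hrA hx0 (by rwa [abs_of_nonneg hx0] at hxr)
      exact ⟨u, hwin1 u hu, by rw [hγu, hphi], hsu⟩
    · rw [not_le] at hx0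
      have hm2 : m = 2 := by
        rcases hsign with h | h
        · exact h
        · exact absurd h (not_le.2 hx0)
      have hx0' : 0 ≤ -x := by linarith
      obtain ⟨u, hu, hγu, hsu⟩ := bft_ray_bwd D hη hdirB hrB hx0' (by rwa [abs_of_neg hx0] at hxr)
      refine ⟨u, hwin2 u hu, ?_, by rw [hsu, neg_neg]⟩
      rw [hγu, hphi, hm2, pow_add, Complex.I_sq]
      push_cast
      ring
  · have hι : ι < 0 := by omega
    have hm' : m = 1 ∨ m = 3 := by omega
    rcases hm' with rfl | rfl
    · obtain ⟨hphi, hle⟩ := bft_foot_bwd_one D hδ K hclos hι hnear1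
      rw [(bft_vert_bwd_one K X Y hι).2] at hphi ⊢
      set x := bftSposZ 1 δ Pre Pim X Y ι with hx
      have hxr : -x < r := by
        have h := hdist (K + 2)
        rw [hphi, dist_eq_norm, add_sub_cancel_left, norm_mul, norm_mul, hnormI, Complex.norm_I,
          mul_one, mul_one, Complex.norm_real, Real.norm_eq_abs, abs_of_nonneg (by linarith)] at h
        exact h
      obtain ⟨u, hu, hγu, hsu⟩ := bft_ray_bwd D hη hdirB hrB (by linarith : 0 ≤ -x) hxr
      refine ⟨u, hwin2 u hu, ?_, by rw [hsu, neg_neg]⟩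
      rw [hγu, hphi, pow_succ]
      ring
    · obtain ⟨hphi, hlt⟩ := bft_foot_bwd_three D hδ K hclos hι hnear1
      rw [(bft_vert_bwd_three K X Y hι).2] at hphi ⊢
      set x := bftSposZ 3 δ Pre Pim X Y ι with hx
      have hxr : -x < r := by
        have h := hdist (K + 0)
        rw [hphi, dist_eq_norm, add_sub_cancel_left, norm_mul, norm_mul, hnormI, Complex.norm_I,
          mul_one, mul_one, Complex.norm_real, Real.norm_eq_abs, abs_of_neg hlt] at h
        exact h
      obtain ⟨u, hu, hγu, hsu⟩ := bft_ray_bwd D hη hdirB hrB (by linarith : 0 ≤ -x) hxr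
      refine ⟨u, hwin2 u hu, ?_, by rw [hsu, neg_neg]⟩
      rw [hγu, hphi, pow_add, pow_succ, pow_two, Complex.I_mul_I]
      push_cast
      ring

/-- **The data of a chain dart whose vertex sees the chart**: it is exterior, the walk moves to
the next chain dart, and its foot is `γ u` for a window parameter `u` with signed position
`bftSposZ … ι`, equal to the foot parameter `bftPar` up to an integer. [folklore] -/
theorem bft_chain_data (D : JordanDomain) {δ : ℝ} (hδ : 0 < δ) {V : Finset (ℤ × ℤ)}
    (hV : ∀ v : ℤ × ℤ, v ∈ V ↔ bftMesh δ v ∈ closure D.carrier) {t₀ r η : ℝ} (K : Fin 4) {m : ℕ}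
    (hη : 0 < η) (hm : m = 1 ∨ m = 2 ∨ m = 3)
    (hdirA : ∀ t ∈ Icc t₀ (t₀ + η), D.boundary t =
      D.boundary t₀ + ((‖D.boundary t - D.boundary t₀‖ : ℝ) : ℂ) * Complex.I ^ (K : ℕ))
    (hrA : r < ‖D.boundary (t₀ + η) - D.boundary t₀‖)
    (hdirB : ∀ t ∈ Icc (t₀ - η) t₀, D.boundary t =
      D.boundary t₀ + ((‖D.boundary t - D.boundary t₀‖ : ℝ) : ℂ) * Complex.I ^ ((K : ℕ) + m))
    (hrB : r < ‖D.boundary (t₀ - η) - D.boundary t₀‖)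
    (hclos : ∀ z, dist z (D.boundary t₀) < r → (z ∈ closure D.carrier ↔
      (m = 1 → 0 ≤ ((z - D.boundary t₀) * (-Complex.I) ^ (K : ℕ)).re ∧
          0 ≤ ((z - D.boundary t₀) * (-Complex.I) ^ (K : ℕ)).im) ∧
        (m = 2 → 0 ≤ ((z - D.boundary t₀) * (-Complex.I) ^ (K : ℕ)).im) ∧
        (m = 3 → 0 ≤ ((z - D.boundary t₀) * (-Complex.I) ^ (K : ℕ)).im ∨
          ((z - D.boundary t₀) * (-Complex.I) ^ (K : ℕ)).re ≤ 0)))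
    {Pre Pim : ℝ} (hPre : Pre = (D.boundary t₀ * (-Complex.I) ^ (K : ℕ)).re)
    (hPim : Pim = (D.boundary t₀ * (-Complex.I) ^ (K : ℕ)).im) (ι : ℤ)
    (hnear : ∀ z, dist z (bftMesh δ (bftVert m K (bftX m δ Pre) ⌈Pim / δ⌉ ι)) ≤ 3 * δ →
      dist z (D.boundary t₀) < r) :
    bftVert m K (bftX m δ Pre) ⌈Pim / δ⌉ ι ∈ V ∧
    dartTip (bftVert m K (bftX m δ Pre) ⌈Pim / δ⌉ ι, K + bftKoff m ι) ∉ V ∧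
    dsucc V (bftVert m K (bftX m δ Pre) ⌈Pim / δ⌉ ι, K + bftKoff m ι) =
      (bftVert m K (bftX m δ Pre) ⌈Pim / δ⌉ (ι + 1), K + bftKoff m (ι + 1)) ∧
    ∃ u, u ∈ Ioo (t₀ - η) (t₀ + η) ∧
      D.boundary u = bftPhi D δ (bftVert m K (bftX m δ Pre) ⌈Pim / δ⌉ ι, K + bftKoff m ι) ∧
      bftSpos D t₀ u = bftSposZ m δ Pre Pim (bftX m δ Pre) ⌈Pim / δ⌉ ι ∧
      ∃ j : ℤ, bftPar D δ (bftVert m K (bftX m δ Pre) ⌈Pim / δ⌉ ι, K + bftKoff m ι) = u + j := by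
  subst hPre hPim
  have hch := bft_frame_chart D hδ hV K hm hclos _ hnear
  obtain ⟨hvV, htip, hsucc⟩ := bft_ext_succ V hm K _ _ ι hch
  obtain ⟨u, hu, hγu, hsu⟩ := bft_dart_param D hδ hV K hη hm hdirA hrA hdirB hrB hclos ι hnear
  have htip' : dartTip (bftVert m K (bftX m δ (D.boundary t₀ * (-Complex.I) ^ (K : ℕ)).re)
      ⌈(D.boundary t₀ * (-Complex.I) ^ (K : ℕ)).im / δ⌉ ι, K + bftKoff m ι) ∉ V := htip
  have hfr : bftPhi D δ (bftVert m K (bftX m δ (D.boundary t₀ * (-Complex.I) ^ (K : ℕ)).re)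
      ⌈(D.boundary t₀ * (-Complex.I) ^ (K : ℕ)).im / δ⌉ ι, K + bftKoff m ι) ∈ frontier D.carrier :=
    bft_phi_frontier D hδ.le _ ((hV _).1 hvV) (fun h => htip' ((hV _).2 h))
  obtain ⟨j, hj⟩ := bft_par_of_eq D _ hfr hγu
  exact ⟨hvV, htip', hsucc, u, hu, hγu, hsu, j, hj⟩

end Summit.CriticalPhenomena.CardyFormulaZ2.Cruxes.RectilinearCardy.ExcursionKernelCovariance

end
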